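import Summits.AtomisticToContinuum.BoseEinsteinCondensation.Theorems.BECRichardsonGaudinRichardsonAnchorBECPenalisedLowerBoundCore
import Literature.MathematicalPhysics.QuantumManyBody.TorusBoseFockLayer
import Mathlib.Analysis.PSeries
import HarnessLib

/-!
# Crux `RichardsonAnchorBEC` (stmt-AtomisticToContinuum-14805), route `BECRichardsonGaudin`, line `registered` —
# stub `stub_windowLattice`

Lattice bookkeeping for the infrared window `W = B_M ∖ B_R` of the Born trial state, where
`B_ℓ = momentumBand ℓ = {m ∈ ℤ³ : |m j| ≤ ℓ ∀ j}` is the cube of half-side `ℓ` and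
`k_m = waveVector L m`, `‖k_m‖² = 4π² |m|² / L²` (`norm_waveVector_sq`, `|m|² = Σ_j (m j)²`).
For `L > 0` and all `R M : ℕ` we prove

* (a) `(1/(2L³)) Σ_{m ∈ B_R ∖ {0}} 1/‖k_m‖² ≤ 13 R / (4π² L)`;
* (b) `m ∉ B_R ⇒ ‖k_m‖² ≥ 4π² (R+1)² / L²`;
* (c) `Σ_{m ∈ B_M ∖ B_R} 1/‖k_m‖⁴ ≤ 13 L⁴ / (4π⁴ (R+1))`;
* (d) if `2R + 1 ≤ M`, `Σ_{m ∈ B_M ∖ B_R} 1/‖k_m‖⁴ ≥ L⁴ / (24 π⁴ (R+1))`.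

Paper step (pure cube-shell counting in `ℤ³`, no physics): the shell `Sh_n = B_{n+1} ∖ B_n` has
`#Sh_n = (2n+3)³ − (2n+1)³ = 24(n+1)² + 2 ∈ [24(n+1)², 26(n+1)²]` points
(`Fintype.card_piFinset`, `Int.card_Icc`, `Finset.card_sdiff_of_subset`), and on it
`(n+1)² ≤ |m|² ≤ 3(n+1)²`. Decomposing `B_M ∖ B_R = ⊔_{n=R}^{M-1} Sh_n`
(`Finset.sdiff_union_sdiff_cancel`, induction on `M`) gives (a) with `Σ_{n<R} 26 = 26R`, (c) with
the tail bound `Σ_{n ≥ R} 1/(n+1)² ≤ 2/(R+1)` (Mathlib's `sum_Ioo_inv_sq_le`), and (d) from the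
`R+1` shells `n = R, …, 2R`, each contributing `≥ 24(n+1)² · L⁴/(144π⁴(n+1)⁴) ≥ L⁴/(6π⁴(2R+1)²)`,
and `(R+1)/(6(2R+1)²) ≥ 1/(24(R+1))`. (b) is immediate from `∃ j, |m j| ≥ R+1`. Mathlib +
`TorusBoseFockLayer` (`momentumBand`, `mem_momentumBand`, `waveVector`, `norm_waveVector_sq`) only.
-/

noncomputable section

open MeasureTheory Filter
open scoped ENNReal NNReal ComplexConjugate BigOperators

namespace Summit.AtomisticToContinuum.BoseEinsteinCondensation.Cruxes.RichardsonAnchorBEC.Birth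

open Literature.MathematicalPhysics.QuantumManyBody.BoseGas

/-! ## Cubes and cube shells in `ℤ³` -/

/-- Monotonicity of the cubes: `B_a ⊆ B_b` for `a ≤ b`. [folklore] -/
theorem wl_momentumBand_mono {a b : ℕ} (h : a ≤ b) : momentumBand a ⊆ momentumBand b := by
  intro m hm
  rw [mem_momentumBand] at hm ⊢
  exact fun j => (hm j).trans (by exact_mod_cast h)

/-- The cube of half-side `0` is the origin: `B_0 = {0}`. [folklore] -/
theorem wl_momentumBand_zero : momentumBand 0 = {0} := by
  ext m
  rw [mem_momentumBand, Finset.mem_singleton]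
  constructor
  · intro h
    funext j
    have hj := h j
    simp only [Nat.cast_zero, abs_nonpos_iff] at hj
    exact hj
  · rintro rfl j
    simp

/-- `#B_n = (2n+1)³`. [folklore] -/
theorem wl_card_momentumBand (n : ℕ) : (momentumBand n).card = (2 * n + 1) ^ 3 := by
  have hcardI : (Finset.Icc (-(n : ℤ)) n).card = 2 * n + 1 := by
    rw [Int.card_Icc]; omega
  simp only [momentumBand]
  rw [Fintype.card_piFinset, Finset.prod_const, Finset.card_univ, Fintype.card_fin, hcardI]

/-- The cube shell `Sh_n = B_{n+1} ∖ B_n` has `(2n+3)³ − (2n+1)³ = 24(n+1)² + 2` points.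
[folklore] -/
theorem wl_card_shell (n : ℕ) :
    (momentumBand (n + 1) \ momentumBand n).card = 24 * (n + 1) ^ 2 + 2 := by
  rw [Finset.card_sdiff_of_subset (wl_momentumBand_mono (Nat.le_add_right n 1)),
    wl_card_momentumBand, wl_card_momentumBand]
  have : (2 * (n + 1) + 1) ^ 3 = (2 * n + 1) ^ 3 + (24 * (n + 1) ^ 2 + 2) := by ring
  omega

/-- Off the cube `B_R` some coordinate is `≥ R+1` in absolute value, so `|m|² ≥ (R+1)²`.
[folklore] -/
theorem wl_sq_le_normSq_of_not_mem {R : ℕ} {m : Momentum} (hm : m ∉ momentumBand R) :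
    ((R : ℝ) + 1) ^ 2 ≤ ∑ j, ((m j : ℤ) : ℝ) ^ 2 := by
  rw [mem_momentumBand, not_forall] at hm
  obtain ⟨j, hj⟩ := hm
  have hj' : (R : ℤ) + 1 ≤ |m j| := Int.add_one_le_iff.mpr (not_le.mp hj)
  have h1 : ((R : ℝ) + 1) ^ 2 ≤ ((m j : ℤ) : ℝ) ^ 2 := by
    have h2 : ((R : ℤ) + 1) ^ 2 ≤ (m j) ^ 2 := by
      calc ((R : ℤ) + 1) ^ 2 ≤ |m j| ^ 2 := pow_le_pow_left₀ (by positivity) hj' 2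
        _ = (m j) ^ 2 := sq_abs _
    exact_mod_cast h2
  exact h1.trans (Finset.single_le_sum (f := fun i => ((m i : ℤ) : ℝ) ^ 2)
    (fun i _ => sq_nonneg _) (Finset.mem_univ j))

/-- On the cube `B_M` every coordinate is `≤ M` in absolute value, so `|m|² ≤ 3M²`. [folklore] -/
theorem wl_normSq_le_of_mem {M : ℕ} {m : Momentum} (hm : m ∈ momentumBand M) :
    ∑ j, ((m j : ℤ) : ℝ) ^ 2 ≤ 3 * (M : ℝ) ^ 2 := by
  rw [mem_momentumBand] at hm
  have hj : ∀ j, ((m j : ℤ) : ℝ) ^ 2 ≤ (M : ℝ) ^ 2 := by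
    intro j
    have h := hm j
    rw [abs_le] at h
    have h1 : -(M : ℝ) ≤ ((m j : ℤ) : ℝ) := by exact_mod_cast h.1
    have h2 : ((m j : ℤ) : ℝ) ≤ (M : ℝ) := by exact_mod_cast h.2
    exact sq_le_sq' h1 h2
  calc ∑ j, ((m j : ℤ) : ℝ) ^ 2 ≤ ∑ _j : Fin 3, (M : ℝ) ^ 2 := Finset.sum_le_sum fun j _ => hj j
    _ = 3 * (M : ℝ) ^ 2 := by
        rw [Finset.sum_const, Finset.card_univ, Fintype.card_fin, nsmul_eq_mul, Nat.cast_ofNat]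

/-! ## The wave vectors on and off the cubes -/

/-- (b) Off the cube `B_R`: `‖k_m‖² ≥ 4π²(R+1)²/L²`. [folklore] -/
theorem wl_normSq_waveVector_lower (L : ℝ) {R : ℕ} {m : Momentum} (hm : m ∉ momentumBand R) :
    4 * Real.pi ^ 2 * ((R : ℝ) + 1) ^ 2 / L ^ 2 ≤ ‖waveVector L m‖ ^ 2 := by
  rw [norm_waveVector_sq]
  have h := wl_sq_le_normSq_of_not_mem hm
  gcongr

/-- On the cube `B_M`: `‖k_m‖² ≤ 12π²M²/L²`. [folklore] -/
theorem wl_normSq_waveVector_upper (L : ℝ) {M : ℕ} {m : Momentum} (hm : m ∈ momentumBand M) :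
    ‖waveVector L m‖ ^ 2 ≤ 12 * Real.pi ^ 2 * (M : ℝ) ^ 2 / L ^ 2 := by
  rw [norm_waveVector_sq]
  have h := wl_normSq_le_of_mem hm
  calc 4 * Real.pi ^ 2 * (∑ j, ((m j : ℤ) : ℝ) ^ 2) / L ^ 2
      ≤ 4 * Real.pi ^ 2 * (3 * (M : ℝ) ^ 2) / L ^ 2 := by gcongr
    _ = 12 * Real.pi ^ 2 * (M : ℝ) ^ 2 / L ^ 2 := by ring

/-- Off the cube `B_n`: `1/‖k_m‖² ≤ L²/(4π²(n+1)²)`. [folklore] -/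
theorem wl_inv_normSq_le {L : ℝ} (hL : 0 < L) {n : ℕ} {m : Momentum} (hm : m ∉ momentumBand n) :
    1 / ‖waveVector L m‖ ^ 2 ≤ L ^ 2 / (4 * Real.pi ^ 2 * ((n : ℝ) + 1) ^ 2) := by
  have h := wl_normSq_waveVector_lower L hm
  have hpos : 0 < 4 * Real.pi ^ 2 * ((n : ℝ) + 1) ^ 2 / L ^ 2 := by positivity
  calc 1 / ‖waveVector L m‖ ^ 2 ≤ 1 / (4 * Real.pi ^ 2 * ((n : ℝ) + 1) ^ 2 / L ^ 2) :=
        one_div_le_one_div_of_le hpos h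
    _ = L ^ 2 / (4 * Real.pi ^ 2 * ((n : ℝ) + 1) ^ 2) := one_div_div _ _

/-- Off the cube `B_n`: `1/‖k_m‖⁴ ≤ L⁴/(16π⁴(n+1)⁴)`. [folklore] -/
theorem wl_inv_norm_four_le {L : ℝ} (hL : 0 < L) {n : ℕ} {m : Momentum}
    (hm : m ∉ momentumBand n) :
    1 / ‖waveVector L m‖ ^ 4 ≤ L ^ 4 / (16 * Real.pi ^ 4 * ((n : ℝ) + 1) ^ 4) := by
  have h := wl_normSq_waveVector_lower L hm
  have hpos : 0 < 4 * Real.pi ^ 2 * ((n : ℝ) + 1) ^ 2 / L ^ 2 := by positivity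
  have h4 : ‖waveVector L m‖ ^ 4 = (‖waveVector L m‖ ^ 2) ^ 2 := by ring
  have hL' : L ≠ 0 := hL.ne'
  have hpi : Real.pi ≠ 0 := Real.pi_ne_zero
  have hn : (n : ℝ) + 1 ≠ 0 := by positivity
  calc 1 / ‖waveVector L m‖ ^ 4 ≤ 1 / (4 * Real.pi ^ 2 * ((n : ℝ) + 1) ^ 2 / L ^ 2) ^ 2 := by
        rw [h4]
        exact one_div_le_one_div_of_le (by positivity) (pow_le_pow_left₀ hpos.le h 2)
    _ = L ^ 4 / (16 * Real.pi ^ 4 * ((n : ℝ) + 1) ^ 4) := by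
        field_simp
        ring

/-- On the shell `B_{n+1} ∖ B_n`: `1/‖k_m‖⁴ ≥ L⁴/(144π⁴(n+1)⁴)`. [folklore] -/
theorem wl_le_inv_norm_four {L : ℝ} (hL : 0 < L) {n : ℕ} {m : Momentum}
    (hm : m ∈ momentumBand (n + 1) \ momentumBand n) :
    L ^ 4 / (144 * Real.pi ^ 4 * ((n : ℝ) + 1) ^ 4) ≤ 1 / ‖waveVector L m‖ ^ 4 := by
  rw [Finset.mem_sdiff] at hm
  have hlo := wl_normSq_waveVector_lower L hm.2
  have hup := wl_normSq_waveVector_upper L hm.1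
  have hpos : 0 < ‖waveVector L m‖ ^ 2 := lt_of_lt_of_le (by positivity) hlo
  have h4 : ‖waveVector L m‖ ^ 4 = (‖waveVector L m‖ ^ 2) ^ 2 := by ring
  have hL' : L ≠ 0 := hL.ne'
  have hpi : Real.pi ≠ 0 := Real.pi_ne_zero
  have hn : (n : ℝ) + 1 ≠ 0 := by positivity
  calc L ^ 4 / (144 * Real.pi ^ 4 * ((n : ℝ) + 1) ^ 4)
      = 1 / (12 * Real.pi ^ 2 * ((n + 1 : ℕ) : ℝ) ^ 2 / L ^ 2) ^ 2 := by
        push_cast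
        field_simp
        ring
    _ ≤ 1 / ‖waveVector L m‖ ^ 4 := by
        rw [h4]
        exact one_div_le_one_div_of_le (by positivity) (pow_le_pow_left₀ hpos.le hup 2)

/-! ## Shell sums -/

/-- Shell decomposition of a window sum: `Σ_{B_M ∖ B_R} F = Σ_{n=R}^{M-1} Σ_{B_{n+1} ∖ B_n} F`
(both sides vanish if `M ≤ R`). [folklore] -/
theorem wl_sum_window_eq_sum_shells (F : Momentum → ℝ) (R M : ℕ) :
    ∑ m ∈ momentumBand M \ momentumBand R, F m =
      ∑ n ∈ Finset.Ico R M, ∑ m ∈ momentumBand (n + 1) \ momentumBand n, F m := by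
  rcases le_or_gt M R with hMR | hRM
  · rw [Finset.sdiff_eq_empty_iff_subset.mpr (wl_momentumBand_mono hMR),
      Finset.Ico_eq_empty_of_le hMR, Finset.sum_empty, Finset.sum_empty]
  · have hRM' : R ≤ M := hRM.le
    clear hRM
    induction M, hRM' using Nat.le_induction with
    | base => rw [Finset.sdiff_self, Finset.Ico_self, Finset.sum_empty, Finset.sum_empty]
    | succ M hRM ih =>
      rw [Finset.sum_Ico_succ_top hRM, ← ih,
        ← Finset.sdiff_union_sdiff_cancel (wl_momentumBand_mono (Nat.le_add_right M 1))
          (wl_momentumBand_mono hRM),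
        Finset.sum_union (Disjoint.mono_right Finset.sdiff_subset Finset.sdiff_disjoint),
        add_comm]

/-- The tail bound `Σ_{n=R}^{M-1} 1/(n+1)² ≤ 2/(R+1)` (Mathlib's `sum_Ioo_inv_sq_le`). [folklore] -/
theorem wl_sum_Ico_inv_succ_sq_le (R M : ℕ) :
    ∑ n ∈ Finset.Ico R M, 1 / ((n : ℝ) + 1) ^ 2 ≤ 2 / ((R : ℝ) + 1) := by
  have h : ∑ n ∈ Finset.Ico R M, 1 / ((n : ℝ) + 1) ^ 2 =
      ∑ i ∈ Finset.Ioo R (M + 1), ((i : ℝ) ^ 2)⁻¹ := by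
    rw [← Finset.Ico_add_one_left_eq_Ioo,
      ← Finset.sum_Ico_add' (fun i : ℕ => ((i : ℝ) ^ 2)⁻¹) R M 1]
    simp only [one_div, Nat.cast_add, Nat.cast_one]
  rw [h]
  exact sum_Ioo_inv_sq_le R (M + 1)

/-- Shell sum for (a): `Σ_{Sh_n} 1/‖k_m‖² ≤ #Sh_n · L²/(4π²(n+1)²) ≤ 26 L²/(4π²)`. [folklore] -/
theorem wl_shell_sum_inv_normSq_le {L : ℝ} (hL : 0 < L) (n : ℕ) :
    ∑ m ∈ momentumBand (n + 1) \ momentumBand n, 1 / ‖waveVector L m‖ ^ 2 ≤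
      26 * L ^ 2 / (4 * Real.pi ^ 2) := by
  have hpi : Real.pi ≠ 0 := Real.pi_ne_zero
  have hn : (n : ℝ) + 1 ≠ 0 := by positivity
  have hone : (1 : ℝ) ≤ ((n : ℝ) + 1) ^ 2 := by nlinarith [n.cast_nonneg (α := ℝ)]
  calc ∑ m ∈ momentumBand (n + 1) \ momentumBand n, 1 / ‖waveVector L m‖ ^ 2
      ≤ (momentumBand (n + 1) \ momentumBand n).card •
          (L ^ 2 / (4 * Real.pi ^ 2 * ((n : ℝ) + 1) ^ 2)) :=
        Finset.sum_le_card_nsmul _ _ _ fun m hm => wl_inv_normSq_le hL (Finset.mem_sdiff.1 hm).2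
    _ = (24 * ((n : ℝ) + 1) ^ 2 + 2) * (L ^ 2 / (4 * Real.pi ^ 2 * ((n : ℝ) + 1) ^ 2)) := by
        rw [wl_card_shell, nsmul_eq_mul]
        push_cast
        ring
    _ ≤ (26 * ((n : ℝ) + 1) ^ 2) * (L ^ 2 / (4 * Real.pi ^ 2 * ((n : ℝ) + 1) ^ 2)) := by
        gcongr
        linarith
    _ = 26 * L ^ 2 / (4 * Real.pi ^ 2) := by
        field_simp

/-- Shell sum for (c): `Σ_{Sh_n} 1/‖k_m‖⁴ ≤ #Sh_n · L⁴/(16π⁴(n+1)⁴) ≤ (26 L⁴/(16π⁴)) · 1/(n+1)²`.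
[folklore] -/
theorem wl_shell_sum_inv_norm_four_le {L : ℝ} (hL : 0 < L) (n : ℕ) :
    ∑ m ∈ momentumBand (n + 1) \ momentumBand n, 1 / ‖waveVector L m‖ ^ 4 ≤
      26 * L ^ 4 / (16 * Real.pi ^ 4) * (1 / ((n : ℝ) + 1) ^ 2) := by
  have hpi : Real.pi ≠ 0 := Real.pi_ne_zero
  have hn : (n : ℝ) + 1 ≠ 0 := by positivity
  have hone : (1 : ℝ) ≤ ((n : ℝ) + 1) ^ 2 := by nlinarith [n.cast_nonneg (α := ℝ)]
  calc ∑ m ∈ momentumBand (n + 1) \ momentumBand n, 1 / ‖waveVector L m‖ ^ 4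
      ≤ (momentumBand (n + 1) \ momentumBand n).card •
          (L ^ 4 / (16 * Real.pi ^ 4 * ((n : ℝ) + 1) ^ 4)) :=
        Finset.sum_le_card_nsmul _ _ _ fun m hm =>
          wl_inv_norm_four_le hL (Finset.mem_sdiff.1 hm).2
    _ = (24 * ((n : ℝ) + 1) ^ 2 + 2) * (L ^ 4 / (16 * Real.pi ^ 4 * ((n : ℝ) + 1) ^ 4)) := by
        rw [wl_card_shell, nsmul_eq_mul]
        push_cast
        ring
    _ ≤ (26 * ((n : ℝ) + 1) ^ 2) * (L ^ 4 / (16 * Real.pi ^ 4 * ((n : ℝ) + 1) ^ 4)) := by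
        gcongr
        linarith
    _ = 26 * L ^ 4 / (16 * Real.pi ^ 4) * (1 / ((n : ℝ) + 1) ^ 2) := by
        field_simp

/-- Shell sum for (d): `Σ_{Sh_n} 1/‖k_m‖⁴ ≥ #Sh_n · L⁴/(144π⁴(n+1)⁴) ≥ L⁴/(6π⁴(n+1)²)`.
[folklore] -/
theorem wl_le_shell_sum_inv_norm_four {L : ℝ} (hL : 0 < L) (n : ℕ) :
    L ^ 4 / (6 * Real.pi ^ 4 * ((n : ℝ) + 1) ^ 2) ≤
      ∑ m ∈ momentumBand (n + 1) \ momentumBand n, 1 / ‖waveVector L m‖ ^ 4 := by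
  have hpi : Real.pi ≠ 0 := Real.pi_ne_zero
  have hn : (n : ℝ) + 1 ≠ 0 := by positivity
  calc L ^ 4 / (6 * Real.pi ^ 4 * ((n : ℝ) + 1) ^ 2)
      = (24 * ((n : ℝ) + 1) ^ 2) * (L ^ 4 / (144 * Real.pi ^ 4 * ((n : ℝ) + 1) ^ 4)) := by
        field_simp
        ring
    _ ≤ (24 * ((n : ℝ) + 1) ^ 2 + 2) * (L ^ 4 / (144 * Real.pi ^ 4 * ((n : ℝ) + 1) ^ 4)) := by
        gcongr
        linarith
    _ = (momentumBand (n + 1) \ momentumBand n).card •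
          (L ^ 4 / (144 * Real.pi ^ 4 * ((n : ℝ) + 1) ^ 4)) := by
        rw [wl_card_shell, nsmul_eq_mul]
        push_cast
        ring
    _ ≤ ∑ m ∈ momentumBand (n + 1) \ momentumBand n, 1 / ‖waveVector L m‖ ^ 4 :=
        Finset.card_nsmul_le_sum _ _ _ fun m hm => wl_le_inv_norm_four hL hm

/-! ## The four window estimates -/

/-- (a) `(1/(2L³)) Σ_{m ∈ B_R ∖ {0}} 1/‖k_m‖² ≤ 13R/(4π²L)`. [folklore] -/
theorem wl_bandBubble_upper {L : ℝ} (hL : 0 < L) (R : ℕ) :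
    1 / (2 * L ^ 3) * ∑ m ∈ (momentumBand R).erase 0, 1 / ‖waveVector L m‖ ^ 2 ≤
      13 * R / (4 * Real.pi ^ 2 * L) := by
  have hpi : Real.pi ≠ 0 := Real.pi_ne_zero
  have hL' : L ≠ 0 := hL.ne'
  have hsum : ∑ m ∈ (momentumBand R).erase 0, 1 / ‖waveVector L m‖ ^ 2 ≤
      (R : ℝ) * (26 * L ^ 2 / (4 * Real.pi ^ 2)) := by
    rw [← Finset.sdiff_singleton_eq_erase, ← wl_momentumBand_zero,
      wl_sum_window_eq_sum_shells _ 0 R]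
    calc ∑ n ∈ Finset.Ico 0 R, ∑ m ∈ momentumBand (n + 1) \ momentumBand n,
          1 / ‖waveVector L m‖ ^ 2
        ≤ ∑ _n ∈ Finset.Ico 0 R, 26 * L ^ 2 / (4 * Real.pi ^ 2) :=
          Finset.sum_le_sum fun n _ => wl_shell_sum_inv_normSq_le hL n
      _ = (R : ℝ) * (26 * L ^ 2 / (4 * Real.pi ^ 2)) := by
          rw [Finset.sum_const, Nat.card_Ico, Nat.sub_zero, nsmul_eq_mul]
  calc 1 / (2 * L ^ 3) * ∑ m ∈ (momentumBand R).erase 0, 1 / ‖waveVector L m‖ ^ 2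
      ≤ 1 / (2 * L ^ 3) * ((R : ℝ) * (26 * L ^ 2 / (4 * Real.pi ^ 2))) := by gcongr
    _ = 13 * R / (4 * Real.pi ^ 2 * L) := by
        field_simp
        ring

/-- (c) `Σ_{m ∈ B_M ∖ B_R} 1/‖k_m‖⁴ ≤ 13L⁴/(4π⁴(R+1))`. [folklore] -/
theorem wl_window_sum_upper {L : ℝ} (hL : 0 < L) (R M : ℕ) :
    ∑ m ∈ momentumBand M \ momentumBand R, 1 / ‖waveVector L m‖ ^ 4 ≤
      13 * L ^ 4 / (4 * Real.pi ^ 4 * ((R : ℝ) + 1)) := by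
  have hpi : Real.pi ≠ 0 := Real.pi_ne_zero
  have hR : (R : ℝ) + 1 ≠ 0 := by positivity
  rw [wl_sum_window_eq_sum_shells _ R M]
  calc ∑ n ∈ Finset.Ico R M, ∑ m ∈ momentumBand (n + 1) \ momentumBand n, 1 / ‖waveVector L m‖ ^ 4
      ≤ ∑ n ∈ Finset.Ico R M, 26 * L ^ 4 / (16 * Real.pi ^ 4) * (1 / ((n : ℝ) + 1) ^ 2) :=
        Finset.sum_le_sum fun n _ => wl_shell_sum_inv_norm_four_le hL n
    _ = 26 * L ^ 4 / (16 * Real.pi ^ 4) * ∑ n ∈ Finset.Ico R M, 1 / ((n : ℝ) + 1) ^ 2 := by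
        rw [Finset.mul_sum]
    _ ≤ 26 * L ^ 4 / (16 * Real.pi ^ 4) * (2 / ((R : ℝ) + 1)) := by
        gcongr
        exact wl_sum_Ico_inv_succ_sq_le R M
    _ = 13 * L ^ 4 / (4 * Real.pi ^ 4 * ((R : ℝ) + 1)) := by
        field_simp
        ring

/-- (d) For `2R+1 ≤ M`: `Σ_{m ∈ B_M ∖ B_R} 1/‖k_m‖⁴ ≥ L⁴/(24π⁴(R+1))`, from the `R+1` shells
`n = R, …, 2R`. [folklore] -/
theorem wl_window_sum_lower {L : ℝ} (hL : 0 < L) {R M : ℕ} (hM : 2 * R + 1 ≤ M) :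
    L ^ 4 / (24 * Real.pi ^ 4 * ((R : ℝ) + 1)) ≤
      ∑ m ∈ momentumBand M \ momentumBand R, 1 / ‖waveVector L m‖ ^ 4 := by
  have hpi : Real.pi ≠ 0 := Real.pi_ne_zero
  have hR : (R : ℝ) + 1 ≠ 0 := by positivity
  have hR2 : 2 * (R : ℝ) + 1 ≠ 0 := by positivity
  rw [wl_sum_window_eq_sum_shells _ R M]
  calc L ^ 4 / (24 * Real.pi ^ 4 * ((R : ℝ) + 1))
      ≤ ((R : ℝ) + 1) * (L ^ 4 / (6 * Real.pi ^ 4 * (2 * (R : ℝ) + 1) ^ 2)) := by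
        rw [mul_div_assoc', div_le_div_iff₀ (by positivity) (by positivity)]
        have key : 6 * (2 * (R : ℝ) + 1) ^ 2 ≤ 24 * ((R : ℝ) + 1) ^ 2 := by
          nlinarith [R.cast_nonneg (α := ℝ)]
        calc L ^ 4 * (6 * Real.pi ^ 4 * (2 * (R : ℝ) + 1) ^ 2)
            = L ^ 4 * Real.pi ^ 4 * (6 * (2 * (R : ℝ) + 1) ^ 2) := by ring
          _ ≤ L ^ 4 * Real.pi ^ 4 * (24 * ((R : ℝ) + 1) ^ 2) := by gcongr
          _ = (R + 1) * L ^ 4 * (24 * Real.pi ^ 4 * ((R : ℝ) + 1)) := by ring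
    _ = ∑ _n ∈ Finset.Ico R (2 * R + 1), L ^ 4 / (6 * Real.pi ^ 4 * (2 * (R : ℝ) + 1) ^ 2) := by
        rw [Finset.sum_const, Nat.card_Ico, (by omega : 2 * R + 1 - R = R + 1), nsmul_eq_mul]
        push_cast
        ring
    _ ≤ ∑ n ∈ Finset.Ico R (2 * R + 1), ∑ m ∈ momentumBand (n + 1) \ momentumBand n,
          1 / ‖waveVector L m‖ ^ 4 := by
        refine Finset.sum_le_sum fun n hn => ?_
        rw [Finset.mem_Ico] at hn
        have hn1 : (n : ℝ) + 1 ≤ 2 * (R : ℝ) + 1 := by exact_mod_cast Nat.succ_le_of_lt hn.2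
        calc L ^ 4 / (6 * Real.pi ^ 4 * (2 * (R : ℝ) + 1) ^ 2)
            ≤ L ^ 4 / (6 * Real.pi ^ 4 * ((n : ℝ) + 1) ^ 2) := by gcongr
          _ ≤ _ := wl_le_shell_sum_inv_norm_four hL n
    _ ≤ ∑ n ∈ Finset.Ico R M, ∑ m ∈ momentumBand (n + 1) \ momentumBand n,
          1 / ‖waveVector L m‖ ^ 4 :=
        Finset.sum_le_sum_of_subset_of_nonneg (Finset.Ico_subset_Ico_right hM)
          fun n _ _ => Finset.sum_nonneg fun m _ => by positivity

/-- **Window lattice estimates** for the infrared window `W = B_M ∖ B_R` of the Born trial state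
(`B_ℓ = momentumBand ℓ ⊂ ℤ³` the cube of half-side `ℓ`, `k_m = 2πm/L`): for `L > 0`,
(a) `(1/(2L³)) Σ_{m ∈ B_R ∖ {0}} 1/‖k_m‖² ≤ 13R/(4π²L)`; (b) `‖k_m‖² ≥ 4π²(R+1)²/L²` off `B_R`;
(c) `Σ_{m ∈ W} 1/‖k_m‖⁴ ≤ 13L⁴/(4π⁴(R+1))`; (d) `Σ_{m ∈ W} 1/‖k_m‖⁴ ≥ L⁴/(24π⁴(R+1))` once
`2R+1 ≤ M`. Pure cube-shell counting: `#(B_{n+1} ∖ B_n) = 24(n+1)² + 2` and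
`(n+1)² ≤ |m|² ≤ 3(n+1)²` on the shell, plus `Σ_{n ≥ R} 1/(n+1)² ≤ 2/(R+1)`. [folklore] -/
theorem stub_windowLattice :
    ∀ (L : ℝ) (R M : ℕ), 0 < L →
      1 / (2 * L ^ 3) * ∑ m ∈ (momentumBand R).erase 0, 1 / ‖waveVector L m‖ ^ 2 ≤
          13 * R / (4 * Real.pi ^ 2 * L) ∧
      (∀ m : Momentum, m ∉ momentumBand R → 4 * Real.pi ^ 2 * ((R : ℝ) + 1) ^ 2 / L ^ 2 ≤ ‖waveVector L m‖ ^ 2) ∧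
      ∑ m ∈ momentumBand M \ momentumBand R, 1 / ‖waveVector L m‖ ^ 4 ≤
          13 * L ^ 4 / (4 * Real.pi ^ 4 * ((R : ℝ) + 1)) ∧
      (2 * R + 1 ≤ M →
        L ^ 4 / (24 * Real.pi ^ 4 * ((R : ℝ) + 1)) ≤
          ∑ m ∈ momentumBand M \ momentumBand R, 1 / ‖waveVector L m‖ ^ 4) := by
  intro L R M hL
  exact ⟨wl_bandBubble_upper hL R, fun m hm => wl_normSq_waveVector_lower L hm,
    wl_window_sum_upper hL R M, fun hM => wl_window_sum_lower hL hM⟩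

end Summit.AtomisticToContinuum.BoseEinsteinCondensation.Cruxes.RichardsonAnchorBEC.Birth

end
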